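import Summits.RiemannHypothesis.RiemannHypothesis.Theses.OddSector
import Summits.RiemannHypothesis.RiemannHypothesis.Theorems.RuelleBandExactFirstBandStubOddSectorCriterion
import Summits.RiemannHypothesis.RiemannHypothesis.Theorems.OddSectorOddOneSignedWindowsExistence
import Summits.RiemannHypothesis.RiemannHypothesis.Theorems.OddSectorOddOneSignedWindowsRealPart
import Literature.NumberTheory.LFunctions.WeilOddGroundState
import Literature.NumberTheory.LFunctions.WeilGroundEnergyParitySplit
import Literature.NumberTheory.LFunctions.YoshidaOddCriterion
import Literature.NumberTheory.LFunctions.WeilCriterionProofs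
import Literature.NumberTheory.LFunctions.ZetaRealAxis
import Literature.NumberTheory.LFunctions.GeneralizedRH
import HarnessLib

/-!
# `OddSector.OddBartaFloor` (stmt-RiemannHypothesis-17779): negative lemmas of the standing disprover, cycle 1

Crux of route OddSector, rank 3: `OddBartaFloor` = "there are `e → 0` and `a₀` such that at every
window `a ≥ a₀` carrying a ONE-SIGNED odd-sector ground state
(`∃ u, IsWeilOddGroundState a u ∧ ∀ᵐ t ∈ (0,a), Im u = 0 ∧ 0 ≤ Re u`), every `L²`-normalised odd
window test has `Re Q ≥ -e(a)`". No refutation exists and none can: this file lands the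
kernel-checked NEGATIVE knowledge around the crux (the disprover's work file is
`Cruxes/OddBartaFloor/Disproof.lean`; the logical shape `C ↔ (X → RH)` was first recorded by
refuter-rattack in `Cruxes/OddBartaFloor/OddBartaFloorLogic.lean`). Every statement is inline
(no new `def`); conclusions are equivalences with `RiemannHypothesis`, negated/mutated forms of the
crux, or small-model facts — never a Theses decl.

* §1 `oddPositivity_iff_riemannHypothesis` — Yoshida's odd criterion, BOTH halves, assembled from
  the tree (`stub_oddSectorCriterion`, `riemannZeta_ofReal_ne_zero_of_pos_of_lt_one`,
  `riemannHypothesis_iff_strip_holds`; `yoshida_odd_criterion_mp`); it discharges the Literature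
  named fact `yoshida_odd_criterion` Summits-side (`yoshida_odd_criterion_holds`).
* §2 THE TEMPLATE THEOREM `floor_template_iff`: for EVERY window predicate `P`, the floor statement
  "`∃ e → 0, ∃ a₀, ∀ a ≥ a₀, P a →` floor `-e a` on the odd sphere of `[-a,a]`" is equivalent to
  `(∃ᶠ a in atTop, P a) → RiemannHypothesis`. Instances: the crux is `X → RH`
  (`oddBartaFloor_iff_oddOneSignedWindows_imp`), so `¬C ↔ X ∧ ¬RH` (`not_oddBartaFloor_iff`:
  IRREFUTABLE short of `¬RH`); what an RH-free proof must show is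
  `¬RH → eventually every odd-sector ground state changes sign` (`oddBartaFloor_iff_signChange`).
* §3 LOAD-BEARING CLAUSES: deleting the whole hypothesis, or ONLY the sign clause, or ONLY
  `0 ≤ Re u`, or ONLY `Im u = 0`, each turns the crux into `RiemannHypothesis` itself
  (`…without_goodWindow/…without_sign/…without_nonneg/…without_reality_iff_riemannHypothesis`;
  the last by the junk witness `u = I·v`, `Re u ≡ 0`); deleting the decay of `e` makes it a theorem
  (`oddBartaFloor_without_decay`); deleting the threshold `a₀`, or strengthening the conclusion to
  Weil positivity on ALL tests, changes nothing (`…all_windows_iff`, `…all_tests_iff`).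
* MECHANISM MODELS (Barta's inequality in `ℝⁿ`; 2×2 witnesses that the sign of the bottom state
  and the pointwise supersolution inequality on its whole support are load-bearing) are in the
  companion file `Negative/OddBartaFloorBartaModels.lean`.

References: H. Yoshida (1992) Prop. 1(1); E. Bombieri, Rend. Lincei (9) 11 (2000) §4 Thm 3, Thm 5;
J. Barta, C. R. Acad. Sci. Paris 204 (1937) 472–473 (the eigenvalue bound by a positive
supersolution).
-/

noncomputable section

-- D-0017 layout (Sub = Summit) repeats the `RiemannHypothesis` component in every name here.
set_option linter.dupNamespace false

open Filter Set MeasureTheory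
open scoped Topology

namespace Summit.RiemannHypothesis.RiemannHypothesis.Theorems.OddBartaFloor.Negative

open Literature.NumberTheory.LFunctions
open Summit.RiemannHypothesis.RiemannHypothesis.Theses.OddSector
open Summit.RiemannHypothesis.RiemannHypothesis.Theorems.OddSector
  (exists_isWeilOddGroundState_unbounded exists_real_of_isWeilOddGroundState)

/-! ## 1. Odd positivity is the Riemann hypothesis -/

/-- **Odd-sector Weil positivity IS the Riemann hypothesis, unconditionally in the tree.** Hard
half: Summit-side `stub_oddSectorCriterion` (positivity on odd REAL tests puts every zero with
`0 < Re s < 1` on the critical line or the real axis), `riemannZeta_ofReal_ne_zero_of_pos_of_lt_one`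
(no zeros on `(0,1)`) and the strip form `riemannHypothesis_iff_strip_holds`; easy half:
`yoshida_odd_criterion_mp`. [cite: Yoshida1992HermitianForms, Prop. 1(1)] -/
theorem oddPositivity_iff_riemannHypothesis :
    (∀ g : ℝ → ℂ, IsWeilTest g → (∀ t : ℝ, g (-t) = -g t) → 0 ≤ (weilQuadratic g).re) ↔
      _root_.RiemannHypothesis := by
  constructor
  · intro hpos
    have hstrip := Theorems.RuelleBandExactFirstBand.stub_oddSectorCriterion
      (fun g hg hodd _ ↦ hpos g hg hodd)
    refine riemannHypothesis_iff_strip_holds.2 fun s hs h0 h1 ↦ ?_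
    rcases hstrip s hs h0 h1 with h | him
    · exact h
    · exfalso
      have hsre : s = ((s.re : ℝ) : ℂ) := by
        apply Complex.ext <;> simp [him]
      rw [hsre] at hs
      exact riemannZeta_ofReal_ne_zero_of_pos_of_lt_one s.re h0 h1 hs
  · intro hRH g hg hodd
    exact yoshida_odd_criterion_mp hRH g hg hodd

/-- The Literature named fact `yoshida_odd_criterion` (Yoshida 1992 Prop. 1(1) for `k = ℚ`),
discharged Summits-side (Literature cannot import the Summit-side hard half).
[cite: Yoshida1992HermitianForms, Prop. 1(1)] -/
theorem yoshida_odd_criterion_holds : yoshida_odd_criterion :=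
  oddPositivity_iff_riemannHypothesis.symm

/-- Odd positivity in WINDOW form (zero floor on the normalised odd sphere of every window) is odd
positivity (homogeneity, `weilOddGroundEnergy_nonneg_iff`). [folklore] -/
theorem forall_window_oddFloor_iff_oddPositivity :
    (∀ (a : ℝ) (h : ℝ → ℂ), IsWeilTest h → tsupport h ⊆ Icc (-a) a → (∀ t, h (-t) = -h t) →
        ∫ t, ‖h t‖ ^ 2 = (1 : ℝ) → 0 ≤ (weilQuadratic h).re) ↔
      ∀ g : ℝ → ℂ, IsWeilTest g → (∀ t : ℝ, g (-t) = -g t) → 0 ≤ (weilQuadratic g).re := by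
  constructor
  · intro h
    have hε : ∀ a : ℝ, 0 ≤ weilOddGroundEnergy a := fun a ↦ by
      refine Real.sInf_nonneg ?_
      rintro x ⟨g, hg, hs, hodd, hnorm, rfl⟩
      exact h a g hg hs hodd hnorm
    intro g hg hodd
    obtain ⟨a, _, hs⟩ := hg.exists_tsupport_subset_Icc
    exact (weilOddGroundEnergy_nonneg_iff a).1 (hε a) g hg hs hodd
  · intro h a g hg _ hodd _
    exact h g hg hodd

/-! ## 2. The template theorem; irrefutability of the crux -/

/-- **THE TEMPLATE THEOREM.** For every window predicate `P`, the floor statement of the crux with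
hypothesis `P a` is equivalent to `(∃ᶠ a in atTop, P a) → RiemannHypothesis`.
(→) the odd window class is monotone in the window: a normalised odd test of negative energy on
`[-b,b]` lives on every larger window, and `P`-windows with `e a < -Re Q(h)` exist beyond
`max b a₀`; (←) if `P` is frequent, RH gives the zero floor (`yoshida_odd_criterion_mp`); if not,
`P` fails beyond some `A` and the statement is vacuous with `a₀ := A`. [folklore] -/
theorem floor_template_iff (P : ℝ → Prop) :
    (∃ e : ℝ → ℝ, Tendsto e atTop (𝓝 0) ∧ ∃ a₀ : ℝ, ∀ a : ℝ, a₀ ≤ a → P a →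
        ∀ h : ℝ → ℂ, IsWeilTest h → tsupport h ⊆ Icc (-a) a → (∀ t, h (-t) = -h t) →
          ∫ t, ‖h t‖ ^ 2 = (1 : ℝ) → -e a ≤ (weilQuadratic h).re) ↔
      ((∃ᶠ a in atTop, P a) → _root_.RiemannHypothesis) := by
  constructor
  · rintro ⟨e, he, a₀, hfl⟩ hP
    refine oddPositivity_iff_riemannHypothesis.1
      (forall_window_oddFloor_iff_oddPositivity.1 fun b h hh hs hodd hnorm ↦ ?_)
    by_contra hneg
    push Not at hneg
    have hev : ∀ᶠ a in atTop, e a < -(weilQuadratic h).re :=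
      he.eventually (Iio_mem_nhds (by linarith))
    obtain ⟨a, hPa, hea, hba⟩ :=
      (hP.and_eventually (hev.and (eventually_ge_atTop (max b a₀)))).exists
    have hb : b ≤ a := le_trans (le_max_left _ _) hba
    have ha₀ : a₀ ≤ a := le_trans (le_max_right _ _) hba
    have hs' : tsupport h ⊆ Icc (-a) a := hs.trans (Icc_subset_Icc (neg_le_neg hb) hb)
    have h1 := hfl a ha₀ hPa h hh hs' hodd hnorm
    linarith
  · intro H
    by_cases hP : ∃ᶠ a in atTop, P a
    · have hRH := H hP
      exact ⟨fun _ ↦ 0, tendsto_const_nhds, 0, fun a _ _ h hh _ hodd _ ↦ by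
        rw [neg_zero]; exact yoshida_odd_criterion_mp hRH h hh hodd⟩
    · rw [Filter.not_frequently] at hP
      obtain ⟨A, hA⟩ := Filter.eventually_atTop.1 hP
      exact ⟨fun _ ↦ 0, tendsto_const_nhds, A, fun a ha hPa ↦ absurd hPa (hA a ha)⟩

/-- Unfolding: the crux over the Literature vocabulary `IsWeilOddGroundState` / `IsWeilTest` /
`weilQuadratic` (definitional; refuter-rattack's `oddBartaFloor_iff`). [folklore] -/
theorem oddBartaFloor_iff_literature :
    OddBartaFloor ↔
      ∃ e : ℝ → ℝ, Tendsto e atTop (𝓝 0) ∧ ∃ a₀ : ℝ, ∀ a : ℝ, a₀ ≤ a →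
        (∃ u : ℝ → ℂ, IsWeilOddGroundState a u ∧
          (∀ᵐ t : ℝ, t ∈ Ioo 0 a → (u t).im = 0 ∧ 0 ≤ (u t).re)) →
        ∀ h : ℝ → ℂ, IsWeilTest h → tsupport h ⊆ Icc (-a) a → (∀ t, h (-t) = -h t) →
          ∫ t, ‖h t‖ ^ 2 = (1 : ℝ) → -e a ≤ (weilQuadratic h).re :=
  Iff.rfl

/-- The thesis crux `OddOneSignedWindows` says that GOOD windows (those carrying a one-signed
odd-sector ground state) occur frequently at infinity (definitional, `Filter.frequently_atTop`).
[folklore] -/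
theorem oddOneSignedWindows_iff_frequently :
    OddOneSignedWindows ↔ ∃ᶠ a in atTop, ∃ u : ℝ → ℂ, IsWeilOddGroundState a u ∧
      (∀ᵐ t : ℝ, t ∈ Ioo 0 a → (u t).im = 0 ∧ 0 ≤ (u t).re) := by
  rw [Filter.frequently_atTop]
  exact Iff.rfl

/-- **`C ↔ (X → RH)`**: the crux `OddBartaFloor` is EQUIVALENT to the implication
"`OddOneSignedWindows → RiemannHypothesis`" (refuter-rattack's finding; here the instance
`P a := ∃ u, IsWeilOddGroundState a u ∧ (one-signed)` of the template, the crux being that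
instance token for token). [folklore] -/
theorem oddBartaFloor_iff_oddOneSignedWindows_imp :
    OddBartaFloor ↔ (OddOneSignedWindows → _root_.RiemannHypothesis) := by
  rw [oddOneSignedWindows_iff_frequently]
  exact floor_template_iff fun a ↦ ∃ u : ℝ → ℂ, IsWeilOddGroundState a u ∧
    (∀ᵐ t : ℝ, t ∈ Ioo 0 a → (u t).im = 0 ∧ 0 ≤ (u t).re)

/-- **IRREFUTABILITY**: the negation of the crux is the thesis crux AND the failure of RH — no
refuter, computation or barrier can reach it. [folklore] -/
theorem not_oddBartaFloor_iff :
    ¬ OddBartaFloor ↔ (OddOneSignedWindows ∧ ¬ _root_.RiemannHypothesis) := by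
  rw [oddBartaFloor_iff_oddOneSignedWindows_imp, Classical.not_imp]

/-- In particular a refutation of the crux would disprove the Riemann hypothesis. [folklore] -/
theorem not_riemannHypothesis_of_not_oddBartaFloor (h : ¬ OddBartaFloor) :
    ¬ _root_.RiemannHypothesis :=
  (not_oddBartaFloor_iff.1 h).2

/-- **What an RH-free proof of the crux must show**: if RH fails then, beyond some height, EVERY
odd-sector ground state on `[-a,a]` fails the sign clause on `(0,a)` — the contrapositive that the
Barta/theta-vector mechanism is designed to deliver (`¬RH ⇒ ε_od(∞) < 0 ⇒ ε_od(a) < -e(a)`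
eventually, versus `ε_od(a) ≥ -e(a)` at good windows). [folklore] -/
theorem oddBartaFloor_iff_signChange :
    OddBartaFloor ↔
      (¬ _root_.RiemannHypothesis → ∀ᶠ a in atTop, ∀ u : ℝ → ℂ, IsWeilOddGroundState a u →
        ¬ (∀ᵐ t : ℝ, t ∈ Ioo 0 a → (u t).im = 0 ∧ 0 ≤ (u t).re)) := by
  rw [oddBartaFloor_iff_oddOneSignedWindows_imp, oddOneSignedWindows_iff_frequently]
  constructor
  · intro H hRH
    have hnf := mt H hRH
    rw [Filter.not_frequently] at hnf
    exact hnf.mono fun a ha u hu hs ↦ ha ⟨u, hu, hs⟩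
  · intro H hfreq
    by_contra hRH
    obtain ⟨a, ⟨u, hu, hs⟩, hno⟩ := (hfreq.and_eventually (H hRH)).exists
    exact hno u hu hs

/-- The crux with its analytic conclusion replaced by `RiemannHypothesis` itself is still
equivalent to the crux: "`GoodWindow` on a tail of windows is incompatible with `¬RH`".
[folklore] -/
theorem oddBartaFloor_iff_eventually_goodWindow_imp :
    OddBartaFloor ↔ ∃ a₀ : ℝ, ∀ a : ℝ, a₀ ≤ a →
      (∃ u : ℝ → ℂ, IsWeilOddGroundState a u ∧
        (∀ᵐ t : ℝ, t ∈ Ioo 0 a → (u t).im = 0 ∧ 0 ≤ (u t).re)) → _root_.RiemannHypothesis := by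
  rw [oddBartaFloor_iff_oddOneSignedWindows_imp, oddOneSignedWindows_iff_frequently]
  constructor
  · intro H
    by_cases hP : ∃ᶠ a in atTop, ∃ u : ℝ → ℂ, IsWeilOddGroundState a u ∧
        (∀ᵐ t : ℝ, t ∈ Ioo 0 a → (u t).im = 0 ∧ 0 ≤ (u t).re)
    · exact ⟨0, fun _ _ _ ↦ H hP⟩
    · rw [Filter.not_frequently] at hP
      obtain ⟨A, hA⟩ := Filter.eventually_atTop.1 hP
      exact ⟨A, fun a ha hPa ↦ absurd hPa (hA a ha)⟩
  · rintro ⟨a₀, H⟩ hfreq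
    obtain ⟨a, hPa, ha⟩ := (hfreq.and_eventually (eventually_ge_atTop a₀)).exists
    exact H a ha hPa

/-! ## 3. Load-bearing clauses: one mutation at a time -/

/-- **Hypothesis deleted ⇒ RH.** The crux with the good-window hypothesis removed ("floor
`-e(a) → 0` on the odd sphere of ALL large windows") is equivalent to the Riemann hypothesis
(refuter-rattack's `oddBartaFloorWithoutGoodWindow_iff_rh`, as the instance `P := True` of the
template). [folklore] -/
theorem oddBartaFloor_without_goodWindow_iff_riemannHypothesis :
    (∃ e : ℝ → ℝ, Tendsto e atTop (𝓝 0) ∧ ∃ a₀ : ℝ, ∀ a : ℝ, a₀ ≤ a →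
        ∀ h : ℝ → ℂ, IsWeilTest h → tsupport h ⊆ Icc (-a) a → (∀ t, h (-t) = -h t) →
          ∫ t, ‖h t‖ ^ 2 = (1 : ℝ) → -e a ≤ (weilQuadratic h).re) ↔
      _root_.RiemannHypothesis := by
  have hT := floor_template_iff fun _ ↦ True
  have hfreq : ∃ᶠ _a in (atTop : Filter ℝ), True :=
    Filter.Eventually.frequently (Filter.Eventually.of_forall fun _ ↦ trivial)
  constructor
  · rintro ⟨e, he, a₀, hfl⟩
    exact hT.1 ⟨e, he, a₀, fun a ha _ ↦ hfl a ha⟩ hfreq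
  · intro hRH
    obtain ⟨e, he, a₀, hfl⟩ := hT.2 fun _ ↦ hRH
    exact ⟨e, he, a₀, fun a ha ↦ hfl a ha trivial⟩

/-- **Sign clause deleted ⇒ RH.** Keeping only "the window carries SOME odd-sector ground state"
already makes the crux equivalent to the Riemann hypothesis, because odd-sector ground states
EXIST at every window `a > 0` (landed: `exists_isWeilOddGroundState`, Bombieri 2000 Thm 3 in the
odd sector). So the entire RH-content of the crux sits in the sign clause
`∀ᵐ t ∈ (0,a), Im u = 0 ∧ 0 ≤ Re u`. [folklore] -/
theorem oddBartaFloor_without_sign_iff_riemannHypothesis :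
    (∃ e : ℝ → ℝ, Tendsto e atTop (𝓝 0) ∧ ∃ a₀ : ℝ, ∀ a : ℝ, a₀ ≤ a →
        (∃ u : ℝ → ℂ, IsWeilOddGroundState a u) →
        ∀ h : ℝ → ℂ, IsWeilTest h → tsupport h ⊆ Icc (-a) a → (∀ t, h (-t) = -h t) →
          ∫ t, ‖h t‖ ^ 2 = (1 : ℝ) → -e a ≤ (weilQuadratic h).re) ↔
      _root_.RiemannHypothesis :=
  (floor_template_iff _).trans
    ⟨fun h ↦ h (Filter.frequently_atTop.2 fun A ↦ by
        obtain ⟨a, ha, u, hu⟩ := exists_isWeilOddGroundState_unbounded A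
        exact ⟨a, ha, u, hu⟩),
      fun h _ ↦ h⟩

/-- **`0 ≤ Re u` deleted (reality kept) ⇒ RH.** Every window `a > 0` carries a REAL-valued
odd-sector ground state (landed: `exists_real_of_isWeilOddGroundState`), so the mutated hypothesis
is frequent. [folklore] -/
theorem oddBartaFloor_without_nonneg_iff_riemannHypothesis :
    (∃ e : ℝ → ℝ, Tendsto e atTop (𝓝 0) ∧ ∃ a₀ : ℝ, ∀ a : ℝ, a₀ ≤ a →
        (∃ u : ℝ → ℂ, IsWeilOddGroundState a u ∧ ∀ᵐ t : ℝ, t ∈ Ioo 0 a → (u t).im = 0) →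
        ∀ h : ℝ → ℂ, IsWeilTest h → tsupport h ⊆ Icc (-a) a → (∀ t, h (-t) = -h t) →
          ∫ t, ‖h t‖ ^ 2 = (1 : ℝ) → -e a ≤ (weilQuadratic h).re) ↔
      _root_.RiemannHypothesis :=
  (floor_template_iff _).trans
    ⟨fun h ↦ h (Filter.frequently_atTop.2 fun A ↦ by
        obtain ⟨a, ha, u, hu⟩ := exists_isWeilOddGroundState_unbounded A
        obtain ⟨v, hv, hreal⟩ := exists_real_of_isWeilOddGroundState hu
        exact ⟨a, ha, v, hv, Filter.Eventually.of_forall fun t _ ↦ hreal t⟩),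
      fun h _ ↦ h⟩

/-- **`Im u = 0` deleted (`0 ≤ Re u` kept) ⇒ RH**, by a JUNK witness: for a real ground state `v`
the phase-rotated `u := I·v` is a ground state (`IsWeilOddGroundState.const_mul`) with
`Re u ≡ 0 ≥ 0`. So the reality conjunct is load-bearing too: without it the sign clause is vacuous.
[folklore] -/
theorem oddBartaFloor_without_reality_iff_riemannHypothesis :
    (∃ e : ℝ → ℝ, Tendsto e atTop (𝓝 0) ∧ ∃ a₀ : ℝ, ∀ a : ℝ, a₀ ≤ a →
        (∃ u : ℝ → ℂ, IsWeilOddGroundState a u ∧ ∀ᵐ t : ℝ, t ∈ Ioo 0 a → 0 ≤ (u t).re) →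
        ∀ h : ℝ → ℂ, IsWeilTest h → tsupport h ⊆ Icc (-a) a → (∀ t, h (-t) = -h t) →
          ∫ t, ‖h t‖ ^ 2 = (1 : ℝ) → -e a ≤ (weilQuadratic h).re) ↔
      _root_.RiemannHypothesis :=
  (floor_template_iff _).trans
    ⟨fun h ↦ h (Filter.frequently_atTop.2 fun A ↦ by
        obtain ⟨a, ha, u, hu⟩ := exists_isWeilOddGroundState_unbounded A
        obtain ⟨v, hv, hreal⟩ := exists_real_of_isWeilOddGroundState hu
        refine ⟨a, ha, fun t ↦ Complex.I * v t, hv.const_mul (by simp), ?_⟩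
        exact Filter.Eventually.of_forall fun t _ ↦ by simp [Complex.mul_re, hreal t]),
      fun h _ ↦ h⟩

/-- **Decay of `e` deleted ⇒ a THEOREM** (refuter-rattack): with an unconstrained floor one takes
`e a := -ε_od(a)`, the odd sphere being bounded below (`weilOddGroundEnergy_le`). So
`Tendsto e atTop (𝓝 0)` is the only constraint on `e`. [folklore] -/
theorem oddBartaFloor_without_decay :
    ∃ e : ℝ → ℝ, ∃ a₀ : ℝ, ∀ a : ℝ, a₀ ≤ a →
      (∃ u : ℝ → ℂ, IsWeilOddGroundState a u ∧
        (∀ᵐ t : ℝ, t ∈ Ioo 0 a → (u t).im = 0 ∧ 0 ≤ (u t).re)) →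
      ∀ h : ℝ → ℂ, IsWeilTest h → tsupport h ⊆ Icc (-a) a → (∀ t, h (-t) = -h t) →
        ∫ t, ‖h t‖ ^ 2 = (1 : ℝ) → -e a ≤ (weilQuadratic h).re :=
  ⟨fun a ↦ -weilOddGroundEnergy a, 0, fun a _ _ h hh hs hodd hnorm ↦ by
    rw [neg_neg]; exact weilOddGroundEnergy_le hh hs hodd hnorm⟩

/-- **Threshold `a₀` deleted ⇒ nothing changes**: the floor claimed at EVERY good window (no `a₀`)
is equivalent to the crux, since `e` is unconstrained on bounded window sets (patch `e := -ε_od`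
below `a₀`). Hence no finite set of windows, and no computation, bears on the crux. [folklore] -/
theorem oddBartaFloor_all_windows_iff :
    (∃ e : ℝ → ℝ, Tendsto e atTop (𝓝 0) ∧ ∀ a : ℝ,
        (∃ u : ℝ → ℂ, IsWeilOddGroundState a u ∧
          (∀ᵐ t : ℝ, t ∈ Ioo 0 a → (u t).im = 0 ∧ 0 ≤ (u t).re)) →
        ∀ h : ℝ → ℂ, IsWeilTest h → tsupport h ⊆ Icc (-a) a → (∀ t, h (-t) = -h t) →
          ∫ t, ‖h t‖ ^ 2 = (1 : ℝ) → -e a ≤ (weilQuadratic h).re) ↔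
      OddBartaFloor := by
  rw [oddBartaFloor_iff_literature]
  constructor
  · rintro ⟨e, he, hfl⟩
    exact ⟨e, he, 0, fun a _ ↦ hfl a⟩
  · rintro ⟨e, he, a₀, hfl⟩
    refine ⟨fun a ↦ if a₀ ≤ a then e a else -weilOddGroundEnergy a, ?_, fun a hgood ↦ ?_⟩
    · refine he.congr' ?_
      filter_upwards [eventually_ge_atTop a₀] with a ha
      rw [if_pos ha]
    · by_cases ha : a₀ ≤ a
      · simpa only [if_pos ha] using hfl a ha hgood
      · intro h hh hs hodd hnorm
        simp only [if_neg ha, neg_neg]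
        exact weilOddGroundEnergy_le hh hs hodd hnorm

/-- **Conclusion strengthened to Weil positivity on ALL tests ⇒ nothing changes**: oddness,
support, normalisation and the slack `-e(a)` in the conclusion are decoration — "`∃ a₀`, every
good window `a ≥ a₀` gives `WeilPositivity`" is equivalent to the crux (frequent good windows give
RH by the crux, whence `WeilPositivity` by `weil_criterion_holds`; otherwise both sides are
vacuous). [folklore] -/
theorem oddBartaFloor_all_tests_iff :
    (∃ a₀ : ℝ, ∀ a : ℝ, a₀ ≤ a →
        (∃ u : ℝ → ℂ, IsWeilOddGroundState a u ∧
          (∀ᵐ t : ℝ, t ∈ Ioo 0 a → (u t).im = 0 ∧ 0 ≤ (u t).re)) → WeilPositivity) ↔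
      OddBartaFloor := by
  rw [oddBartaFloor_iff_eventually_goodWindow_imp]
  constructor
  · rintro ⟨a₀, H⟩
    exact ⟨a₀, fun a ha hgood ↦ weil_criterion_holds.2 (H a ha hgood)⟩
  · rintro ⟨a₀, H⟩
    exact ⟨a₀, fun a ha hgood ↦ weil_criterion_holds.1 (H a ha hgood)⟩

/-- **Either sign will do**: a window carries a one-signed odd-sector ground state iff it carries
a REAL one that is `≥ 0` OR `≤ 0` a.e. on `(0,a)` (pass to `-u`, `IsWeilOddGroundState.neg`); the
choice `0 ≤ Re u` in the crux is a normalisation, not a restriction. [folklore] -/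
theorem goodWindow_iff_real_oneSigned_either {a : ℝ} :
    (∃ u : ℝ → ℂ, IsWeilOddGroundState a u ∧
        (∀ᵐ t : ℝ, t ∈ Ioo 0 a → (u t).im = 0 ∧ 0 ≤ (u t).re)) ↔
      ∃ u : ℝ → ℂ, IsWeilOddGroundState a u ∧ (∀ᵐ t : ℝ, t ∈ Ioo 0 a → (u t).im = 0) ∧
        ((∀ᵐ t : ℝ, t ∈ Ioo 0 a → 0 ≤ (u t).re) ∨ (∀ᵐ t : ℝ, t ∈ Ioo 0 a → (u t).re ≤ 0)) := by
  constructor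
  · rintro ⟨u, hu, hs⟩
    exact ⟨u, hu, hs.mono fun t ht hta ↦ (ht hta).1, Or.inl (hs.mono fun t ht hta ↦ (ht hta).2)⟩
  · rintro ⟨u, hu, hreal, hsign | hsign⟩
    · exact ⟨u, hu, (hreal.and hsign).mono fun t ht hta ↦ ⟨ht.1 hta, ht.2 hta⟩⟩
    · refine ⟨fun t ↦ -u t, hu.neg, (hreal.and hsign).mono fun t ht hta ↦ ⟨?_, ?_⟩⟩
      · simp [ht.1 hta]
      · have := ht.2 hta
        simp only [Complex.neg_re]
        linarith

end Summit.RiemannHypothesis.RiemannHypothesis.Theorems.OddBartaFloor.Negative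

end
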